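import Summits.NavierStokesRegularity.NavierStokesRegularity.Theorems.StrainDoorsLocalNewtonB3
import HarnessLib

/-!
# StrainDoorsLocalNewtonFloatingDefs — TEXTS of door D8♮ «FloatingLocalNewtonParityDoor» (D8 with a shell that FLOATS above a floor)

Door D8 (`Theorems/StrainDoorsLocalNewton`, ROUND-45, closed by name in `Theorems/StrainDoorsLocalNewtonB3`) fixes the shell
`(r₀,r₁)` of the pressure-free local near feed once and for all. Here the shell is allowed to FLOAT: at each charged almost strain
maximiser `(t,x,e)` SOME dilation `γ ≥ γ₀` of the reference shell may be used (door D8♮, `FloatingLocalNewtonParityDoor`; `γ ≡ 1`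
is D8, `localNewtonParityDoor_of_floating`). The price is the SCALE DEPENDENCE of the one constant of atom B3: the engine hypothesis
`HessSmoothingDilateBound` (the LEAD S-door's R48 pre-typing text «B3Scaling» (s2): `|∫ λ^{γ}_ee(z)·ϖ(v)(x−z) dz| ≤
C(r₀,r₁)·(γ⁻⁵∫‖v‖² + γ⁻³∫|∇v|²_F)`), under which ONE budget `b(t) = C(γ₀⁻⁵ + γ₀⁻³)(‖u(0)‖₂² + ‖∇u(t)‖₂²)` pays the smoothing
term of EVERY shell above the floor (plate B♮ `FloatingSmoothingBudget`, `floatingSmoothingBudget_of_dilate`: the tree's a.e.-gauge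
engine `le_of_gauge_ae`, B1/B2/B4 at the dilated scales, A3′/A3⁺/A3a), and the door follows over plate R (every `t`, any scales) and
D5 (`floatingLocalNewtonParityDoor_of`, ★★ `floatingLocalNewtonParityDoor_of_dilate`). READING (numbers): the budget density is
`C(γ₀⁻⁵E + γ₀⁻³G(t))`, time-integrable iff the floor `γ₀ > 0`; a window tied to the parabolic core `r(t) ~ √(ν(T−t))` has no floor
and its density `~ (T−t)^{−5/2}` is NOT integrable — the typed location of the supercritical gap (LEAD 2026-08-29T00:56:13Z).
THIS FILE: the three texts only (review lane); the kernel-checked compositions are in `Theorems/StrainDoorsLocalNewtonFloating`.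
`--supports stmt-NavierStokesRegularity-0056 --as helper` (ns-s29-p2 g5; LEAD S-door plate map R47→R48, t-leg).

HONEST FRAME: a CONDITIONAL continuation criterion (hypothesis = near-feed parity at a floating shell) and kernel-checked
compositions; its one NS-free input beyond the tree is the scaling law `HessSmoothingDilateBound` (taken as a hypothesis here);
items 0056 `NoTypeII`, 10661 and NS regularity are NOT proved; nothing here is a route or a summit statement.
-/

noncomputable section

open MeasureTheory Set Function Filter Metric Real InnerProductSpace
open _root_.Topology
open scoped ENNReal NNReal RealInnerProductSpace ContDiff
open Literature.Analysis Literature.Analysis.FluidPDE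

set_option linter.dupNamespace false

namespace Summit.NavierStokesRegularity.NavierStokesRegularity.Theorems.StrainDoors

/-! ## §1 Texts -/

/-- ENGINE HYPOTHESIS «B3Scaling» (s2, LEAD S-door R48 pre-typing; NS-free, fixed time): the constant of atom B3 for the DILATED
shell `(γr₀, γr₁)` is `C(r₀,r₁)·γ⁻⁵` on the energy and `C(r₀,r₁)·γ⁻³` on the dissipation. -/
def HessSmoothingDilateBound : Prop :=
  ∀ (r₀ r₁ : ℝ), 0 < r₀ → r₀ < r₁ → ∃ C : ℝ, 0 ≤ C ∧ ∀ (γ : ℝ), 0 < γ →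
    ∀ (v : (EuclideanSpace ℝ (Fin 3)) → (EuclideanSpace ℝ (Fin 3))),
      ContDiff ℝ ∞ v → (∀ n : ℕ, ∫⁻ x, ‖iteratedFDeriv ℝ n v x‖ₑ ^ 2 < ⊤) →
      ∀ (x e : EuclideanSpace ℝ (Fin 3)), ‖e‖ = 1 →
        |∫ z, smoothingHessKernel (γ * r₀) (γ * r₁) e z * normalisedPressure v (x - z)| ≤
          C * (γ⁻¹ ^ 5 * (∫ y, ‖v y‖ ^ 2) + γ⁻¹ ^ 3 * VectorCalculus.gradNormSq v)

/-- PLATE B♮ «FloatingSmoothingBudget»: ONE time-integrable budget on `[t₀,T)` pays the smoothing term of EVERY dilation `γ ≥ γ₀`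
of the reference shell. -/
def FloatingSmoothingBudget : Prop :=
  ∀ (ν T t₀ r₀ r₁ γ₀ : ℝ) (u : ℝ → (EuclideanSpace ℝ (Fin 3)) → (EuclideanSpace ℝ (Fin 3)))
    (p : ℝ → (EuclideanSpace ℝ (Fin 3)) → ℝ), 0 < ν → 0 ≤ t₀ → t₀ < T → 0 < r₀ → r₀ < r₁ → 0 < γ₀ →
    IsClassicalNSSolutionOn (Ico 0 T) ν 0 u p →
    (∀ T'' < T, HasBoundedSobolevNormsOn (Icc 0 T'') u) →
    ∃ (β : ℝ) (Φ b : ℝ → ℝ), Φ t₀ = 0 ∧ (∀ t ∈ Ico t₀ T, 0 ≤ Φ t ∧ Φ t ≤ β ∧ HasDerivAt Φ (b t) t) ∧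
      ∀ t ∈ Ico t₀ T, ∀ (x e : EuclideanSpace ℝ (Fin 3)), ‖e‖ = 1 → ∀ (γ : ℝ), γ₀ ≤ γ →
        |smoothingTerm (γ * r₀) (γ * r₁) p t x e| ≤ b t

/-- DOOR D8♮ «FloatingLocalNewtonParityDoor» (reference shell `0 < r₀ < r₁`, floor `γ₀ > 0`): if on `[t₀,T)` at every `δ`-almost
strain maximiser above level `l₀` there is SOME dilation `γ ≥ γ₀` at which the pressure-free local near feed of the shell
`(γr₀, γr₁)` is at most `λ_max²`, the solution continues past `T`. (`γ ≡ 1`: door D8.) -/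
def FloatingLocalNewtonParityDoor : Prop :=
  ∀ (ν T t₀ l₀ δ r₀ r₁ γ₀ : ℝ), 0 < ν → 0 ≤ t₀ → t₀ < T → 0 < l₀ → 0 < δ → δ < 1 → 0 < r₀ → r₀ < r₁ → 0 < γ₀ →
    ∀ (u : ℝ → (EuclideanSpace ℝ (Fin 3)) → (EuclideanSpace ℝ (Fin 3)))
      (p : ℝ → (EuclideanSpace ℝ (Fin 3)) → ℝ),
      IsClassicalNSSolutionOn (Ico 0 T) ν 0 u p →
      (∀ T'' < T, HasBoundedSobolevNormsOn (Icc 0 T'') u) →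
      (∀ t ∈ Ico t₀ T, ∀ (x e : EuclideanSpace ℝ (Fin 3)), IsStrainAlmostArgmax δ u t x e →
        l₀ < strainQuad u t x e →
        ∃ γ : ℝ, γ₀ ≤ γ ∧ newtonNearFeed (γ * r₀) (γ * r₁) u t x e ≤ strainQuad u t x e ^ 2) →
      HasSobolevExtensionPast ν u T

end Summit.NavierStokesRegularity.NavierStokesRegularity.Theorems.StrainDoors

end
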